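/-
Copyright (c) 2026. All rights reserved.
Released under Apache 2.0 license as described in the file LICENSE.
-/
import Mathlib
import HarnessLib
import Summits.RiemannHypothesis.RiemannHypothesis.Theorems.EarlyAppointmentsCombHelpers

/-!
# Finsum bounds for pole sum imaginary parts

Helper lemmas for bounding the imaginary part of pole sums over zeros.
These support the G decomposition limit argument in GDecompLimit.
-/

open Complex Real Set Filter Topology Metric
open scoped BigOperators Topology ComplexConjugate

noncomputable section

namespace GDecompFinsum

variable {f : ℂ → ℂ} {x₀ h R : ℝ}

/-- The imaginary point c = x₀ + ih. -/
def c (x₀ h : ℝ) : ℂ := (x₀ : ℂ) + h * I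

/-- The conjugate point c_conj = x₀ - ih. -/
def c_conj (x₀ h : ℝ) : ℂ := (x₀ : ℂ) - h * I

/-- c_conj ≠ c when h > 0. -/
theorem c_conj_ne_c (hh : 0 < h) : c_conj x₀ h ≠ c x₀ h := by
  simp only [c, c_conj]
  intro heq
  have him : ((x₀ : ℂ) - h * I).im = ((x₀ : ℂ) + h * I).im := congrArg Complex.im heq
  simp only [sub_im, ofReal_im, mul_im, ofReal_re, I_im, mul_one, I_re, mul_zero,
    add_im, add_zero] at him
  linarith

/-- For real w, Im(1/(c - w)) ≤ 0 when h > 0. -/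
theorem im_inv_c_sub_real_nonpos (hh : 0 < h) (ξ : ℝ) :
    ((c x₀ h - (ξ : ℂ))⁻¹).im ≤ 0 := by
  simp only [c]
  have h_im := Summit.RiemannHypothesis.RiemannHypothesis.Theorems.EarlyAppointmentsCombHelpers.im_inv_z₀_sub_real
    x₀ h ξ (ne_of_gt hh)
  rw [h_im]
  apply div_nonpos_of_nonpos_of_nonneg
  · linarith
  · nlinarith [sq_nonneg (x₀ - ξ), sq_nonneg h]

/-- The conjugate term contributes exactly -1/(2h). -/
theorem im_inv_c_sub_conj (hh : 0 < h) :
    ((c x₀ h - c_conj x₀ h)⁻¹).im = -1 / (2 * h) := by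
  simp only [c, c_conj]
  have hdiff : ((x₀ : ℂ) + h * I) - ((x₀ : ℂ) - h * I) = 2 * h * I := by ring
  rw [hdiff]
  have h2hne : (2 * h : ℂ) ≠ 0 := by simp; linarith
  rw [mul_comm (2 * (h : ℂ)) I, mul_inv, Complex.inv_I]
  simp only [neg_mul, Complex.neg_im, Complex.mul_im, Complex.I_re, Complex.I_im,
    zero_mul, one_mul]
  have h_inv_re : ((2 : ℂ) * h)⁻¹.re = (2 * h : ℝ)⁻¹ := by
    have h2eq : (2 : ℂ) * ↑h = ↑(2 * h) := by push_cast; ring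
    rw [h2eq, ← Complex.ofReal_inv, Complex.ofReal_re]
  rw [h_inv_re]
  show -(0 + (2 * h)⁻¹) = -1 / (2 * h)
  field_simp
  ring

/-- Key finsum bound: sum over zeros (excluding c) ≤ conjugate term + comb sum.
    Uses that non-real zeros must be c or c_conj, and real zeros contribute ≤ 0. -/
theorem finsum_im_bound (hh : 0 < h) (hhR : h < R)
    (hz₀_conj : f (c_conj x₀ h) = 0)
    (honly_pair : ∀ w : ℂ, ‖w - (x₀ : ℂ)‖ < R → f w = 0 → w.im ≠ 0 →
      (w = c x₀ h ∨ w = c_conj x₀ h))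
    (zeros_finite : {w | f w = 0 ∧ ‖w - (x₀ : ℂ)‖ < R}.Finite)
    (hc_in : c x₀ h ∈ zeros_finite.toFinset)
    (S : Finset ℝ) (hS : ∀ ξ ∈ S, f (ξ : ℂ) = 0 ∧ |ξ - x₀| ≤ h) :
    (∑ w ∈ zeros_finite.toFinset, if w = c x₀ h then 0 else (c x₀ h - w)⁻¹).im ≤
      -1 / (2 * h) + ∑ ξ ∈ S, ((c x₀ h - (ξ : ℂ))⁻¹).im := by
  -- c_conj is in zeros
  have hconj_in : c_conj x₀ h ∈ zeros_finite.toFinset := by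
    rw [Set.Finite.mem_toFinset]
    constructor
    · exact hz₀_conj
    · simp only [c_conj]
      have heq : ((x₀ : ℂ) - h * I) - (x₀ : ℂ) = -h * I := by ring
      rw [heq]
      have h1 : ‖(-h : ℂ) * I‖ = ‖(h : ℂ)‖ * ‖I‖ := by
        rw [show (-h : ℂ) * I = -(h * I) by ring, norm_neg, norm_mul]
      rw [h1, Complex.norm_real, Complex.norm_I, mul_one, Real.norm_eq_abs, abs_of_pos hh]
      exact hhR

  have hconj_ne_c := c_conj_ne_c hh (x₀ := x₀)

  -- Convert if-else sum to sum over erased set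
  have h_sum_eq : (∑ w ∈ zeros_finite.toFinset,
      if w = c x₀ h then 0 else (c x₀ h - w)⁻¹) =
      ∑ w ∈ zeros_finite.toFinset.erase (c x₀ h), (c x₀ h - w)⁻¹ := by
    rw [← Finset.add_sum_erase _ _ hc_in]
    simp only [↓reduceIte, zero_add]
    apply Finset.sum_congr rfl
    intro w hw
    have hne : w ≠ c x₀ h := Finset.ne_of_mem_erase hw
    simp only [hne, ↓reduceIte]

  rw [h_sum_eq]

  -- Split out the conj(c) term
  have hconj_in_erase : c_conj x₀ h ∈ zeros_finite.toFinset.erase (c x₀ h) := by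
    rw [Finset.mem_erase]
    exact ⟨hconj_ne_c, hconj_in⟩

  rw [← Finset.add_sum_erase _ _ hconj_in_erase]

  -- All remaining zeros are real
  have h_rest_real : ∀ w ∈ (zeros_finite.toFinset.erase (c x₀ h)).erase (c_conj x₀ h),
      w.im = 0 := by
    intro w hw
    have hne_conj : w ≠ c_conj x₀ h := Finset.ne_of_mem_erase hw
    have hw' : w ∈ zeros_finite.toFinset.erase (c x₀ h) := Finset.mem_of_mem_erase hw
    have hne_c : w ≠ c x₀ h := Finset.ne_of_mem_erase hw'
    have hw_in : w ∈ zeros_finite.toFinset := Finset.mem_of_mem_erase hw'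
    rw [Set.Finite.mem_toFinset] at hw_in
    have hfw : f w = 0 := hw_in.1
    have hw_near : ‖w - (x₀ : ℂ)‖ < R := hw_in.2
    by_contra him_ne
    have h_pair := honly_pair w hw_near hfw him_ne
    cases h_pair with
    | inl hc => exact hne_c hc
    | inr hconj => exact hne_conj hconj

  -- Each remaining term has Im ≤ 0
  have h_rest_im_neg : ∀ w ∈ (zeros_finite.toFinset.erase (c x₀ h)).erase (c_conj x₀ h),
      ((c x₀ h - w)⁻¹).im ≤ 0 := by
    intro w hw
    have hw_real := h_rest_real w hw
    have hw_eq : w = (w.re : ℂ) := by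
      apply Complex.ext
      · simp
      · simp [hw_real]
    rw [hw_eq]
    exact im_inv_c_sub_real_nonpos hh w.re

  -- S embeds into rest
  have hS_subset : ∀ ξ ∈ S, (ξ : ℂ) ∈ (zeros_finite.toFinset.erase (c x₀ h)).erase (c_conj x₀ h) := by
    intro ξ hξS
    obtain ⟨hfξ, hξ_near⟩ := hS ξ hξS
    simp only [Finset.mem_erase, Set.Finite.mem_toFinset]
    refine ⟨?_, ?_, ?_, ?_⟩
    · simp only [c_conj, ne_eq]
      intro heq
      have him : (ξ : ℂ).im = ((x₀ : ℂ) - h * I).im := congrArg Complex.im heq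
      simp only [ofReal_im, sub_im, mul_im, ofReal_re, I_im, mul_one, I_re, mul_zero] at him
      linarith
    · simp only [c, ne_eq]
      intro heq
      have him : (ξ : ℂ).im = ((x₀ : ℂ) + h * I).im := congrArg Complex.im heq
      simp only [ofReal_im, add_im, mul_im, ofReal_re, I_im, mul_one, I_re, mul_zero,
        add_zero] at him
      linarith
    · exact hfξ
    · simp only [Complex.norm_real, ← Complex.ofReal_sub, Real.norm_eq_abs]
      calc |ξ - x₀| ≤ h := hξ_near
        _ < R := hhR

  -- Taking Im is additive
  have h_im_add : ((c x₀ h - c_conj x₀ h)⁻¹ +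
      ∑ w ∈ (zeros_finite.toFinset.erase (c x₀ h)).erase (c_conj x₀ h),
        (c x₀ h - w)⁻¹).im =
      ((c x₀ h - c_conj x₀ h)⁻¹).im +
      (∑ w ∈ (zeros_finite.toFinset.erase (c x₀ h)).erase (c_conj x₀ h),
        (c x₀ h - w)⁻¹).im := Complex.add_im _ _
  rw [h_im_add, im_inv_c_sub_conj hh]

  -- Sum Im is additive
  have h_sum_im : (∑ w ∈ (zeros_finite.toFinset.erase (c x₀ h)).erase (c_conj x₀ h),
      (c x₀ h - w)⁻¹).im =
      ∑ w ∈ (zeros_finite.toFinset.erase (c x₀ h)).erase (c_conj x₀ h),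
        ((c x₀ h - w)⁻¹).im := by
    induction (zeros_finite.toFinset.erase (c x₀ h)).erase (c_conj x₀ h) using Finset.induction with
    | empty => simp
    | @insert w T hw ih =>
      simp only [Finset.sum_insert hw, Complex.add_im, ih]

  rw [h_sum_im]

  -- Define S_image
  let rest := (zeros_finite.toFinset.erase (c x₀ h)).erase (c_conj x₀ h)
  let S_image : Finset ℂ := S.map ⟨(↑· : ℝ → ℂ), Complex.ofReal_injective⟩

  have hS_image_sub : S_image ⊆ rest := by
    intro w hw
    rw [Finset.mem_map] at hw
    obtain ⟨ξ, hξ, rfl⟩ := hw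
    exact hS_subset ξ hξ

  have h_S_sum : ∑ w ∈ S_image, ((c x₀ h - w)⁻¹).im =
      ∑ ξ ∈ S, ((c x₀ h - (ξ : ℂ))⁻¹).im := by
    simp only [S_image, Finset.sum_map, Function.Embedding.coeFn_mk]

  -- Monotonicity: sum over rest ≤ sum over S
  have h_mono : ∑ w ∈ rest, ((c x₀ h - w)⁻¹).im ≤
      ∑ ξ ∈ S, ((c x₀ h - (ξ : ℂ))⁻¹).im := by
    rw [← Finset.sum_sdiff hS_image_sub, ← h_S_sum]
    have h_extra_neg : ∑ w ∈ rest \ S_image, ((c x₀ h - w)⁻¹).im ≤ 0 := by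
      apply Finset.sum_nonpos
      intro w hw
      rw [Finset.mem_sdiff] at hw
      exact h_rest_im_neg w hw.1
    linarith

  linarith [h_mono]

end GDecompFinsum

end
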